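import Mathlib

/-!
# Candidate proof of `stub_landau` (line `tauberian-omega-limit`, crux stmt-NavierStokesRegularity-10493)

Refuter scratch (drefute seat): the pure real-analysis Tauberian step is TRUE as stated in the skeleton
`Cruxes/AdaptedFrequencyConverges/Lines/tauberian-omega-limit.lean`.  `SlowlyDecreasingAt` is copied verbatim
from the skeleton; `stub_landau` below has exactly the registered signature.  Positive content — not landed by
the refuter; attached as candidate evidence for the lead / a prover to transplant.
-/

open scoped Topology
open Set Filter

namespace Refuter.Drefute.Landau

/-- verbatim from the skeleton -/
def SlowlyDecreasingAt (f : ℝ → ℝ) (T : ℝ) : Prop :=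
  ∀ ε > 0, ∃ t₁ < T, ∀ t t' : ℝ, t₁ ≤ t → t ≤ t' → t' < T → T - t ≤ 2 * (T - t') → f t ≤ f t' + ε

/-- Forward chaining of the slow-decrease inequality over `K` dyadic windows starting at `a`. -/
theorem chain_fwd {f : ℝ → ℝ} {T tε ε : ℝ} (hε : 0 ≤ ε)
    (h : ∀ t t' : ℝ, tε ≤ t → t ≤ t' → t' < T → T - t ≤ 2 * (T - t') → f t ≤ f t' + ε)
    {a : ℝ} (ha : tε ≤ a) :
    ∀ K : ℕ, ∀ t : ℝ, a ≤ t → t < T → T - a ≤ 2 ^ K * (T - t) → f a ≤ f t + K * ε := by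
  intro K
  induction K with
  | zero =>
    intro t hat htT hK
    rw [pow_zero, one_mul] at hK
    have : t = a := le_antisymm (by linarith) hat
    subst this; simp
  | succ K ih =>
    intro t hat htT hK
    by_cases hc : T - a ≤ 2 * (T - t)
    · have h1 := h a t ha hat htT hc
      have hKε : (0:ℝ) ≤ K * ε := by positivity
      push_cast; linarith
    · push Not at hc
      have e1 : (2:ℝ) ^ (K + 1) * (T - t) = 2 ^ K * (T - (2 * t - T)) := by rw [pow_succ]; ring
      have has : a ≤ 2 * t - T := by linarith
      have hst : 2 * t - T ≤ t := by linarith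
      have hsT : 2 * t - T < T := by linarith
      have hKs : T - a ≤ 2 ^ K * (T - (2 * t - T)) := by rw [← e1]; exact hK
      have h1 := ih (2 * t - T) has hsT hKs
      have h2 := h (2 * t - T) t (ha.trans has) hst htT (by linarith)
      push_cast; linarith

/-- Backward chaining of the slow-decrease inequality over `K` dyadic windows ending at `b`. -/
theorem chain_bwd {f : ℝ → ℝ} {T tε ε : ℝ} (hε : 0 ≤ ε)
    (h : ∀ t t' : ℝ, tε ≤ t → t ≤ t' → t' < T → T - t ≤ 2 * (T - t') → f t ≤ f t' + ε)
    {b : ℝ} (hb : b < T) :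
    ∀ K : ℕ, ∀ t : ℝ, tε ≤ t → t ≤ b → T - t ≤ 2 ^ K * (T - b) → f t ≤ f b + K * ε := by
  intro K
  induction K with
  | zero =>
    intro t htε htb hK
    rw [pow_zero, one_mul] at hK
    have : t = b := le_antisymm htb (by linarith)
    subst this; simp
  | succ K ih =>
    intro t htε htb hK
    by_cases hc : T - t ≤ 2 * (T - b)
    · have h1 := h t b htε htb hb hc
      have hKε : (0:ℝ) ≤ K * ε := by positivity
      push_cast; linarith
    · push Not at hc
      have e1 : (2:ℝ) ^ (K + 1) * (T - b) = 2 * (2 ^ K * (T - b)) := by rw [pow_succ]; ring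
      have hts : t ≤ (T + t) / 2 := by linarith
      have hsb : (T + t) / 2 ≤ b := by linarith
      have hsT : (T + t) / 2 < T := by linarith
      have hKs : T - (T + t) / 2 ≤ 2 ^ K * (T - b) := by rw [e1] at hK; linarith
      have h1 := ih ((T + t) / 2) (htε.trans hts) hsb hKs
      have h2 := h t ((T + t) / 2) htε hts hsT (by linarith)
      push_cast; linarith

/-- Abstract Landau step: `F` bounded on `[t₁, T)` with `dF/dt = (Λ − 2)/(T − t)` (i.e. `dF/ds = Λ − 2`,
`s = −log (T−t)`) and `Λ` slowly decreasing over dyadic windows ⇒ `Λ → 2`. -/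
theorem landau_core {T t₁ lo hi : ℝ} {Λ F : ℝ → ℝ} (ht₁ : t₁ < T)
    (hFd : ∀ t ∈ Ico t₁ T, HasDerivAt F ((Λ t - 2) / (T - t)) t)
    (hFlo : ∀ t ∈ Ico t₁ T, lo ≤ F t) (hFhi : ∀ t ∈ Ico t₁ T, F t ≤ hi)
    (hsd : SlowlyDecreasingAt Λ T) :
    Tendsto Λ (𝓝[<] T) (𝓝 2) := by
  -- derivative of `log (T - ·)`
  have hlogd : ∀ t < T, HasDerivAt (fun s : ℝ => Real.log (T - s)) ((0 - 1) / (T - t)) t := by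
    intro t ht
    have h0 : HasDerivAt (fun s : ℝ => T - s) (0 - 1) t := (hasDerivAt_const t T).sub (hasDerivAt_id' t)
    exact h0.log (sub_pos.2 ht).ne'
  -- (1) gain: if `Λ ≥ 2 + η` on `[a, b]` then `F b - F a ≥ η (log (T-a) - log (T-b))`
  have gain : ∀ a b η : ℝ, t₁ ≤ a → a ≤ b → b < T → 0 ≤ η →
      (∀ t ∈ Icc a b, 2 + η ≤ Λ t) → η * (Real.log (T - a) - Real.log (T - b)) ≤ F b - F a := by
    intro a b η hta hab hbT hη hΛ
    have hD : ∀ t ∈ Icc a b, HasDerivAt (fun s => F s + η * Real.log (T - s))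
        ((Λ t - 2) / (T - t) + η * ((0 - 1) / (T - t))) t := by
      intro t ht
      have htI : t ∈ Ico t₁ T := ⟨hta.trans ht.1, lt_of_le_of_lt ht.2 hbT⟩
      exact (hFd t htI).add ((hlogd t htI.2).const_mul η)
    have key : MonotoneOn (fun s => F s + η * Real.log (T - s)) (Icc a b) := by
      apply monotoneOn_of_deriv_nonneg (convex_Icc a b)
      · exact fun t ht => (hD t ht).continuousAt.continuousWithinAt
      · intro t ht
        rw [interior_Icc] at ht
        exact (hD t ⟨ht.1.le, ht.2.le⟩).differentiableAt.differentiableWithinAt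
      · intro t ht
        rw [interior_Icc] at ht
        have hTt : 0 < T - t := sub_pos.2 (ht.2.trans hbT)
        rw [(hD t ⟨ht.1.le, ht.2.le⟩).deriv]
        have hΛt := hΛ t ⟨ht.1.le, ht.2.le⟩
        have : (Λ t - 2) / (T - t) + η * ((0 - 1) / (T - t)) = (Λ t - 2 - η) / (T - t) := by
          field_simp; ring
        rw [this]
        exact div_nonneg (by linarith) hTt.le
    have := key ⟨le_rfl, hab⟩ ⟨hab, le_rfl⟩ hab
    simp only at this
    linarith
  -- (2) loss: if `Λ ≤ 2 - η` on `[a, b]` then `F b - F a ≤ -η (log (T-a) - log (T-b))`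
  have loss : ∀ a b η : ℝ, t₁ ≤ a → a ≤ b → b < T → 0 ≤ η →
      (∀ t ∈ Icc a b, Λ t ≤ 2 - η) → F b - F a ≤ -(η * (Real.log (T - a) - Real.log (T - b))) := by
    intro a b η hta hab hbT hη hΛ
    have hD : ∀ t ∈ Icc a b, HasDerivAt (fun s => F s - η * Real.log (T - s))
        ((Λ t - 2) / (T - t) - η * ((0 - 1) / (T - t))) t := by
      intro t ht
      have htI : t ∈ Ico t₁ T := ⟨hta.trans ht.1, lt_of_le_of_lt ht.2 hbT⟩
      exact (hFd t htI).sub ((hlogd t htI.2).const_mul η)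
    have key : AntitoneOn (fun s => F s - η * Real.log (T - s)) (Icc a b) := by
      apply antitoneOn_of_deriv_nonpos (convex_Icc a b)
      · exact fun t ht => (hD t ht).continuousAt.continuousWithinAt
      · intro t ht
        rw [interior_Icc] at ht
        exact (hD t ⟨ht.1.le, ht.2.le⟩).differentiableAt.differentiableWithinAt
      · intro t ht
        rw [interior_Icc] at ht
        have hTt : 0 < T - t := sub_pos.2 (ht.2.trans hbT)
        rw [(hD t ⟨ht.1.le, ht.2.le⟩).deriv]
        have hΛt := hΛ t ⟨ht.1.le, ht.2.le⟩
        have : (Λ t - 2) / (T - t) - η * ((0 - 1) / (T - t)) = (Λ t - 2 + η) / (T - t) := by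
          field_simp; ring
        rw [this]
        exact div_nonpos_of_nonpos_of_nonneg (by linarith) hTt.le
    have := key ⟨le_rfl, hab⟩ ⟨hab, le_rfl⟩ hab
    simp only at this
    linarith
  -- (3) contradiction set-up
  rw [Metric.tendsto_nhds]
  by_contra hnot
  push Not at hnot
  obtain ⟨δ, hδ, hfreq⟩ := hnot
  have hfr : ∃ᶠ t in 𝓝[<] T, δ ≤ |Λ t - 2| :=
    hfreq.mono fun t ht => by rwa [Real.dist_eq] at ht
  -- the bound `M` on the oscillation of `F`, the number of windows `K`, the tolerance `ε`
  set M : ℝ := hi - lo with hM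
  have hM0 : 0 ≤ M := by
    have h1 := hFlo t₁ ⟨le_rfl, ht₁⟩
    have h2 := hFhi t₁ ⟨le_rfl, ht₁⟩
    rw [hM]; linarith
  set K : ℕ := ⌈4 * M / δ⌉₊ + 1 with hK
  have hK1 : (1:ℝ) ≤ K := by rw [hK]; push_cast; linarith [Nat.cast_nonneg (α := ℝ) ⌈4 * M / δ⌉₊]
  have hKpos : (0:ℝ) < K := by linarith
  have hKM : 4 * M / δ < K := by
    rw [hK]; push_cast
    linarith [Nat.le_ceil (4 * M / δ)]
  have hKM' : M < δ * K / 4 := by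
    rw [div_lt_iff₀ hδ] at hKM
    linarith
  have hlog2 : (1:ℝ) / 2 < Real.log 2 := by linarith [Real.log_two_gt_d9]
  have hKlog : M < δ / 2 * (K * Real.log 2) := by nlinarith
  set ε : ℝ := δ / (2 * K) with hε
  have hεpos : 0 < ε := by rw [hε]; positivity
  have hKε : (K:ℝ) * ε = δ / 2 := by rw [hε]; field_simp
  obtain ⟨tε, htεT, hsdε⟩ := hsd ε hεpos
  set m : ℝ := max t₁ tε with hm
  have hmT : m < T := max_lt ht₁ htεT
  have h2K : (1:ℝ) ≤ 2 ^ K := one_le_pow₀ (by norm_num)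
  have h2Kpos : (0:ℝ) < 2 ^ K := by positivity
  have hlogpow : Real.log ((2:ℝ) ^ K) = K * Real.log 2 := Real.log_pow 2 K
  -- (4) the two cases
  have hor : (∃ᶠ t in 𝓝[<] T, 2 + δ ≤ Λ t) ∨ (∃ᶠ t in 𝓝[<] T, Λ t ≤ 2 - δ) := by
    rw [← Filter.frequently_or_distrib]
    refine hfr.mono fun t ht => ?_
    rcases le_abs'.1 ht with h | h
    · right; linarith
    · left; linarith
  rcases hor with hA | hB
  · -- Case A: `Λ a ≥ 2 + δ` at some `a ∈ [m, T)`; chain forward over `K` dyadic windows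
    obtain ⟨a, hΛa, ha⟩ := (hA.and_eventually (Ico_mem_nhdsLT hmT)).exists
    have hta : t₁ ≤ a := (le_max_left _ _).trans ha.1
    have htεa : tε ≤ a := (le_max_right _ _).trans ha.1
    have haT : 0 < T - a := sub_pos.2 ha.2
    set τ : ℝ := T - (T - a) / 2 ^ K with hτ
    have hTτ : T - τ = (T - a) / 2 ^ K := by rw [hτ]; ring
    have haτ : a ≤ τ := by
      have : (T - a) / 2 ^ K ≤ T - a := div_le_self haT.le h2K
      linarith
    have hτT : τ < T := by
      have : 0 < (T - a) / 2 ^ K := by positivity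
      linarith
    have hΛw : ∀ t ∈ Icc a τ, 2 + δ / 2 ≤ Λ t := by
      intro t ht
      have htT : t < T := lt_of_le_of_lt ht.2 hτT
      have hwin : T - a ≤ 2 ^ K * (T - t) := by
        have h1 : T - τ ≤ T - t := by linarith [ht.2]
        rw [hTτ, div_le_iff₀ h2Kpos] at h1
        linarith
      have := chain_fwd hεpos.le hsdε htεa K t ht.1 htT hwin
      rw [hKε] at this
      linarith
    have hg := gain a τ (δ / 2) hta haτ hτT (by positivity) hΛw
    have hlogs : Real.log (T - a) - Real.log (T - τ) = K * Real.log 2 := by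
      rw [hTτ, Real.log_div haT.ne' h2Kpos.ne', hlogpow]; ring
    rw [hlogs] at hg
    have hF1 := hFlo a ⟨hta, ha.2⟩
    have hF2 := hFhi τ ⟨hta.trans haτ, hτT⟩
    linarith
  · -- Case B: `Λ b ≤ 2 - δ` at some `b` very close to `T`; chain backward over `K` dyadic windows
    have hm' : T - (T - m) / 2 ^ K < T := by
      have : 0 < (T - m) / 2 ^ K := by have := sub_pos.2 hmT; positivity
      linarith
    obtain ⟨b, hΛb, hb⟩ := (hB.and_eventually (Ico_mem_nhdsLT hm')).exists
    have hbT : 0 < T - b := sub_pos.2 hb.2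
    set σ : ℝ := T - 2 ^ K * (T - b) with hσ
    have hTσ : T - σ = 2 ^ K * (T - b) := by rw [hσ]; ring
    have hmσ : m ≤ σ := by
      have h1 : T - b ≤ (T - m) / 2 ^ K := by linarith [hb.1]
      rw [le_div_iff₀ h2Kpos] at h1
      rw [hσ]; linarith
    have hσb : σ ≤ b := by
      have : T - b ≤ 2 ^ K * (T - b) := le_mul_of_one_le_left hbT.le h2K
      rw [hσ]; linarith
    have htσ : t₁ ≤ σ := (le_max_left _ _).trans hmσ
    have htεσ : tε ≤ σ := (le_max_right _ _).trans hmσ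
    have hΛw : ∀ t ∈ Icc σ b, Λ t ≤ 2 - δ / 2 := by
      intro t ht
      have hwin : T - t ≤ 2 ^ K * (T - b) := by rw [← hTσ]; linarith [ht.1]
      have := chain_bwd hεpos.le hsdε hb.2 K t (htεσ.trans ht.1) ht.2 hwin
      rw [hKε] at this
      linarith
    have hl := loss σ b (δ / 2) htσ hσb hb.2 (by positivity) hΛw
    have hlogs : Real.log (T - σ) - Real.log (T - b) = K * Real.log 2 := by
      rw [hTσ, Real.log_mul h2Kpos.ne' hbT.ne', hlogpow]; ring
    rw [hlogs] at hl
    have hF1 := hFhi σ ⟨htσ, lt_of_le_of_lt hσb hb.2⟩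
    have hF2 := hFlo b ⟨htσ.trans hσb, hb.2⟩
    linarith

/-- `stub_landau` of the skeleton, with exactly the registered signature. -/
theorem stub_landau :
    ∀ (T t₁ : ℝ) (H : ℝ → ℝ), t₁ < T → (∀ t ∈ Ico t₁ T, DifferentiableAt ℝ H t) →
      (∃ c₀ C₁ : ℝ, 0 < c₀ ∧ ∀ t ∈ Ico t₁ T, c₀ ≤ (T - t) ^ 2 * H t ∧ (T - t) ^ 2 * H t ≤ C₁) →
      SlowlyDecreasingAt (fun t => (T - t) * deriv H t / H t) T →
      Tendsto (fun t => (T - t) * deriv H t / H t) (𝓝[<] T) (𝓝 2) := by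
  intro T t₁ H ht₁ hd hp hsd
  obtain ⟨c₀, C₁, hc₀, hpin⟩ := hp
  have hHpos : ∀ t ∈ Ico t₁ T, 0 < H t := by
    intro t ht
    have h1 := (hpin t ht).1
    by_contra hle
    push Not at hle
    have : (T - t) ^ 2 * H t ≤ 0 := mul_nonpos_of_nonneg_of_nonpos (sq_nonneg _) hle
    linarith
  refine landau_core (Λ := fun t => (T - t) * deriv H t / H t)
    (F := fun t => Real.log ((T - t) ^ 2 * H t)) (lo := Real.log c₀) (hi := Real.log C₁) ht₁ ?_ ?_ ?_ hsd
  · intro t ht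
    have hTt : 0 < T - t := sub_pos.2 ht.2
    have hHt := hHpos t ht
    have h0 : HasDerivAt (fun s : ℝ => T - s) (0 - 1) t := (hasDerivAt_const t T).sub (hasDerivAt_id' t)
    have h1 : HasDerivAt (fun s : ℝ => (T - s) ^ 2) (((2:ℕ):ℝ) * (T - t) ^ (2 - 1) * (0 - 1)) t :=
      h0.pow 2
    have hg : HasDerivAt (fun s : ℝ => (T - s) ^ 2 * H s)
        (((2:ℕ):ℝ) * (T - t) ^ (2 - 1) * (0 - 1) * H t + (T - t) ^ 2 * deriv H t) t :=
      h1.mul (hd t ht).hasDerivAt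
    have hne : (T - t) ^ 2 * H t ≠ 0 := by positivity
    have hlog := hg.log hne
    convert hlog using 1
    push_cast
    field_simp
    ring
  · intro t ht
    exact Real.log_le_log hc₀ (hpin t ht).1
  · intro t ht
    have : 0 < (T - t) ^ 2 * H t := by
      have := sub_pos.2 ht.2; have := hHpos t ht; positivity
    exact Real.log_le_log this (hpin t ht).2

end Refuter.Drefute.Landau
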